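import Summits.QuantumFields.YangMills.Theorems.LocalInsertionSublevelDoublingPlaquette
import Summits.QuantumFields.YangMills.Theorems.LangevinControlUVFemtoCurvatureTwoPointCStubSliceOpen
import HarnessLib

/-!
# Sublevel doubling of Wilson's action on `(ℤ/L)^d`, every `d` — the gauge-slice parametrisation covers a neighbourhood (OPEN)

Crux `HistoryTailL` (stmt-QuantumFields-19936), level-0 lane (T4) «uniform doubling», row (T4-SUB), file 7: the `{d : ℕ}`-generic port
(literal `4 ↦ d`, proofs verbatim) of `Theorems/LangevinControlUVFemtoCurvatureTwoPointCStubSliceOpen.lean` (route `LangevinControlUV`,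
crux `FemtoCurvatureTwoPointC`, line `Sketch` v7, `stub_sliceOpen`); its d-FREE lemmas (the local logarithm
`SliceOpen.hasStrictFDerivAt_localLog_one`, `SliceOpen.eventually_localLog_exp`, `SliceOpen.hasStrictFDerivAt_expProd`, and the
log-coordinates `SliceOpen.exists_leftInverse_lieIso`, `SliceOpen.exists_logChart_radius`) are IMPORTED from that file, not copied.

The configurations near `τ` on `(ℤ/L)^d` are parametrised as `gaugeExp η · cfg τ A`: a gauge transformation generated by a site
function `η ⟂ zeroModes τ` applied to the exponential chart point over a 1-form `A` in the gauge slice `slice τ = (range d⁰)ᗮ`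
(vocabulary `…SublevelDoublingDefs`). `sliceOpen`: for every `δ > 0` there is an open `O ∋ τ` all of whose points are
`gaugeExp η · cfg τ A` with `η ∈ (zeroModes τ)ᗮ`, `A ∈ slice τ`, `‖η‖, ‖A‖ < δ`. Proof (inverse function theorem in log-coordinates):
with `M = lieIso r.ρ`, a continuous linear left inverse `Q` of `M` and the local logarithm `localLog`,
`Γ(η, A)(e) = Q (localLog (ρ((gaugeExp η · cfg τ A) e) ρ(τ e)⁻¹))` has strict derivative `(η̇, Ȧ) ↦ d⁰η̇ + Ȧ` on
`(zeroModes τ)ᗮ × slice τ` (`hasStrictFDerivAt_logParam`), ONTO the 1-forms (`exists_dZero_add_eq`); `HasStrictFDerivAt.map_nhds_eq_of_surj`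
and separation of points of `ρ(G)` near `1` by log-coordinates finish. Rung R3 (continuum SU(2) YM₃ on T³) — not infinite volume, not a
mass gap, not Clay. References: inverse function theorem (Mathlib); von Neumann (1929) / Hall (2015), Cor. 3.44 for the chart. No definitions.
-/

set_option autoImplicit false

noncomputable section

open scoped Matrix Matrix.Norms.Frobenius InnerProductSpace Topology ContDiff
open NormedSpace Filter Set
open Literature.MathematicalPhysics.QuantumLattice Literature.MathematicalPhysics.QuantumFieldTheory
open Summit.QuantumFields.YangMills.Theorems.FreeEnergyLogCoefficient
open Literature.Analysis.Calculus (localLog localLog_one contDiffAt_localLog hasStrictFDerivAt_exp_zero_equiv)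
open Summit.QuantumFields.YangMills.Theorems.FemtoCurvatureTwoPointC.Doubling (Fib adFib lieIso_adFib adFib_mul adFib_one
  adFib_inv_apply adFib_apply_inv inner_adFib rho_inv_mul rho_mul_inv rho_matrix_inv isUnit_rho conjTranspose_rho
  rho_inv_conj_conj exp_lieIso_adFib exp_neg_lieIso_adFib expChart_adFib rho_expChart_inv sub_re_trace_eq_norm_sq
  re_trace_conjTranspose_conj_mul)

namespace Summit.QuantumFields.YangMills.Theorems.LocalInsertion.SublevelDoubling

namespace SliceOpen

variable {G : Type} [Group G] [TopologicalSpace G] [CompactSpace G] (r : LatticeRep G)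

variable {d L : ℕ}

/-- **The parametrisation in matrices**: `ρ((gaugeExp η · cfg τ A)(x,i)) ρ(τ(x,i))⁻¹ =
e^{M η(x)} e^{M A(x,i)} ρ(τ(x,i)) e^{−M η(x+eᵢ)} ρ(τ(x,i))⁻¹`. -/
theorem rho_param_mul (τ : GaugeConfig d L G) (η : SiteFun r d L) (A : OneForm r d L) (x : Site d L) (i : Fin d) :
    r.ρ (gaugeTransform (gaugeExp r η) (cfg r τ A) (x, i)) * r.ρ (τ (x, i))⁻¹ =
      exp (lieIso r.ρ (η x)) * exp (lieIso r.ρ (A (x, i))) * r.ρ (τ (x, i)) *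
        exp (-lieIso r.ρ (η (x.shift i))) * r.ρ (τ (x, i))⁻¹ := by
  rw [rho_gaugeTransform_cfg]
  simp only [gaugeExp, rho_expChart r.ρ r.continuous, rho_expChart_inv]

/-- At the zero parameters the matrix `ρ((gaugeExp 0 · cfg τ 0) e) ρ(τ e)⁻¹` is `1`. -/
theorem rho_param_zero (τ : GaugeConfig d L G) (e : Edge d L) :
    r.ρ (gaugeTransform (gaugeExp r (0 : SiteFun r d L)) (cfg r τ (0 : OneForm r d L)) e) * r.ρ (τ e)⁻¹ = 1 := by
  obtain ⟨x, i⟩ := e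
  rw [rho_param_mul]
  simp [rho_mul_inv]

/-- Zero modes are killed by the linearised gauge action: `d⁰ζ = 0` for `ζ ∈ zeroModes τ`. -/
theorem dZero_eq_zero_of_mem_zeroModes (τ : GaugeConfig d L G) {ζ : SiteFun r d L} (hζ : ζ ∈ zeroModes r τ) :
    dZero r τ ζ = 0 := by
  refine PiLp.ext fun e => ?_
  obtain ⟨x, i⟩ := e
  have h := (mem_zeroModes_iff r τ ζ).1 hζ i
  have hx : adFib r (τ (x, i)) (ζ (x.shift i)) = ζ x := by
    simpa using congrArg (fun f : SiteFun r d L => f x) h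
  rw [dZero_apply, hx, sub_self, PiLp.zero_apply]

section L2

variable [NeZero L]

/-- **Strict derivative of the parametrisation at `0`** (matrix form): on `(zeroModes τ)ᗮ × slice τ` the map
`(η, A) ↦ ρ((gaugeExp η · cfg τ A) e) ρ(τ e)⁻¹` has a strict derivative `Φ'` at `0` with `Φ' (η̇, Ȧ) = M ((d⁰η̇ + Ȧ) e)`
(product rule for `e^{M η(x)} e^{M A(e)} T e^{−M η(x+eᵢ)} T⁻¹` and `T (M a) T⁻¹ = M (Ad_T a)`). -/
theorem hasStrictFDerivAt_rhoParam (τ : GaugeConfig d L G) (e : Edge d L) :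
    ∃ Φ' : ↥(zeroModes r τ)ᗮ × ↥(slice r τ) →L[ℝ] Matrix (Fin r.N) (Fin r.N) ℂ,
      HasStrictFDerivAt
        (fun q : ↥(zeroModes r τ)ᗮ × ↥(slice r τ) =>
          r.ρ (gaugeTransform (gaugeExp r (q.1 : SiteFun r d L)) (cfg r τ (q.2 : OneForm r d L)) e) * r.ρ (τ e)⁻¹) Φ' 0 ∧
      ∀ q, Φ' q = lieIso r.ρ (dZero r τ (q.1 : SiteFun r d L) e + (q.2 : OneForm r d L) e) := by
  obtain ⟨x, i⟩ := e
  -- the three linear maps `q ↦ M η(x)`, `q ↦ M A(x,i)`, `q ↦ M η(x+eᵢ)` on `(zeroModes τ)ᗮ × slice τ`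
  let ι₁ : ↥(zeroModes r τ)ᗮ × ↥(slice r τ) →L[ℝ] SiteFun r d L :=
    (zeroModes r τ)ᗮ.subtypeL.comp (ContinuousLinearMap.fst ℝ _ _)
  let ι₂ : ↥(zeroModes r τ)ᗮ × ↥(slice r τ) →L[ℝ] OneForm r d L :=
    (slice r τ).subtypeL.comp (ContinuousLinearMap.snd ℝ _ _)
  let a := (lieIso r.ρ).toContinuousLinearMap.comp ((PiLp.proj 2 (fun _ : Site d L => Fib r) x).comp ι₁)
  let b := (lieIso r.ρ).toContinuousLinearMap.comp ((PiLp.proj 2 (fun _ : Edge d L => Fib r) (x, i)).comp ι₂)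
  let c := (lieIso r.ρ).toContinuousLinearMap.comp ((PiLp.proj 2 (fun _ : Site d L => Fib r) (x.shift i)).comp ι₁)
  obtain ⟨D, hD, hDv⟩ := Summit.QuantumFields.YangMills.Theorems.FemtoCurvatureTwoPointC.SliceOpen.hasStrictFDerivAt_expProd a b c _ _ (rho_mul_inv r (τ (x, i)))
  have h : HasStrictFDerivAt (fun q : ↥(zeroModes r τ)ᗮ × ↥(slice r τ) =>
      r.ρ (gaugeTransform (gaugeExp r (q.1 : SiteFun r d L)) (cfg r τ (q.2 : OneForm r d L)) (x, i)) * r.ρ (τ (x, i))⁻¹)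
      D 0 :=
    hD.congr_of_eventuallyEq (Eventually.of_forall fun q => (rho_param_mul r τ _ _ x i).symm)
  refine ⟨D, h, fun q => (hDv q).trans ?_⟩
  show lieIso r.ρ ((q.1 : SiteFun r d L) x) + lieIso r.ρ ((q.2 : OneForm r d L) (x, i)) -
      r.ρ (τ (x, i)) * lieIso r.ρ ((q.1 : SiteFun r d L) (x.shift i)) * r.ρ (τ (x, i))⁻¹ =
    lieIso r.ρ (dZero r τ (q.1 : SiteFun r d L) (x, i) + (q.2 : OneForm r d L) (x, i))
  rw [map_add, dZero_apply, map_sub, lieIso_adFib]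
  abel

/-- **Continuity of the parametrisation** (matrix form): `(η, A) ↦ ρ((gaugeExp η · cfg τ A) e) ρ(τ e)⁻¹` is continuous on
`(zeroModes τ)ᗮ × slice τ` (a product of exponentials of continuous linear maps). -/
theorem continuous_rhoParam (τ : GaugeConfig d L G) (e : Edge d L) :
    Continuous fun q : ↥(zeroModes r τ)ᗮ × ↥(slice r τ) =>
      r.ρ (gaugeTransform (gaugeExp r (q.1 : SiteFun r d L)) (cfg r τ (q.2 : OneForm r d L)) e) * r.ρ (τ e)⁻¹ := by
  obtain ⟨x, i⟩ := e
  simp only [rho_param_mul]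
  have h₁ : Continuous fun q : ↥(zeroModes r τ)ᗮ × ↥(slice r τ) => (q.1 : SiteFun r d L) :=
    continuous_subtype_val.comp continuous_fst
  have h₂ : Continuous fun q : ↥(zeroModes r τ)ᗮ × ↥(slice r τ) => (q.2 : OneForm r d L) :=
    continuous_subtype_val.comp continuous_snd
  have ha : Continuous fun q : ↥(zeroModes r τ)ᗮ × ↥(slice r τ) => lieIso r.ρ ((q.1 : SiteFun r d L) x) :=
    (lieIso r.ρ).continuous.comp ((PiLp.continuous_apply 2 _ x).comp h₁)
  have hb : Continuous fun q : ↥(zeroModes r τ)ᗮ × ↥(slice r τ) => lieIso r.ρ ((q.2 : OneForm r d L) (x, i)) :=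
    (lieIso r.ρ).continuous.comp ((PiLp.continuous_apply 2 _ (x, i)).comp h₂)
  have hc : Continuous fun q : ↥(zeroModes r τ)ᗮ × ↥(slice r τ) => -lieIso r.ρ ((q.1 : SiteFun r d L) (x.shift i)) :=
    ((lieIso r.ρ).continuous.comp ((PiLp.continuous_apply 2 _ (x.shift i)).comp h₁)).neg
  exact ((((exp_continuous.comp ha).mul (exp_continuous.comp hb)).mul continuous_const).mul
    (exp_continuous.comp hc)).mul continuous_const

/-- **Strict derivative of the log-coordinates of the parametrisation at `0`**: for a left inverse `Q` of `M`, the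
`e`-component `(η, A) ↦ Q (localLog (ρ((gaugeExp η · cfg τ A) e) ρ(τ e)⁻¹))` has a strict derivative `Γ'` at `0` on
`(zeroModes τ)ᗮ × slice τ` with `Γ' (η̇, Ȧ) = (d⁰η̇ + Ȧ) e`. -/
theorem hasStrictFDerivAt_logParam (τ : GaugeConfig d L G) (Q : Matrix (Fin r.N) (Fin r.N) ℂ →L[ℝ] Fib r)
    (hQ : ∀ a, Q (lieIso r.ρ a) = a) (e : Edge d L) :
    ∃ Γ' : ↥(zeroModes r τ)ᗮ × ↥(slice r τ) →L[ℝ] Fib r,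
      HasStrictFDerivAt
        (fun q : ↥(zeroModes r τ)ᗮ × ↥(slice r τ) =>
          Q (localLog (r.ρ (gaugeTransform (gaugeExp r (q.1 : SiteFun r d L)) (cfg r τ (q.2 : OneForm r d L)) e) *
            r.ρ (τ e)⁻¹))) Γ' 0 ∧
      ∀ q, Γ' q = dZero r τ (q.1 : SiteFun r d L) e + (q.2 : OneForm r d L) e := by
  obtain ⟨Φ', h1, hΦ'⟩ := hasStrictFDerivAt_rhoParam r τ e
  have h0 : r.ρ (gaugeTransform (gaugeExp r ((0 : ↥(zeroModes r τ)ᗮ × ↥(slice r τ)).1 : SiteFun r d L))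
      (cfg r τ ((0 : ↥(zeroModes r τ)ᗮ × ↥(slice r τ)).2 : OneForm r d L)) e) * r.ρ (τ e)⁻¹ = 1 := by
    simp only [Prod.fst_zero, Prod.snd_zero, ZeroMemClass.coe_zero]
    exact rho_param_zero r τ e
  have h2 : HasStrictFDerivAt (localLog : Matrix (Fin r.N) (Fin r.N) ℂ → Matrix (Fin r.N) (Fin r.N) ℂ)
      (ContinuousLinearMap.id ℝ _)
      (r.ρ (gaugeTransform (gaugeExp r ((0 : ↥(zeroModes r τ)ᗮ × ↥(slice r τ)).1 : SiteFun r d L))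
        (cfg r τ ((0 : ↥(zeroModes r τ)ᗮ × ↥(slice r τ)).2 : OneForm r d L)) e) * r.ρ (τ e)⁻¹) := by
    rw [h0]; exact Summit.QuantumFields.YangMills.Theorems.FemtoCurvatureTwoPointC.SliceOpen.hasStrictFDerivAt_localLog_one
  have h3 := Q.hasStrictFDerivAt.comp (0 : ↥(zeroModes r τ)ᗮ × ↥(slice r τ))
    (h2.comp (0 : ↥(zeroModes r τ)ᗮ × ↥(slice r τ)) h1)
  exact ⟨_, h3, fun q => (congrArg Q (hΦ' q)).trans (hQ _)⟩

/-- **The linearised parametrisation is onto**: every 1-form is `d⁰η + A` with `η ⟂ zeroModes τ` and `A ∈ slice τ`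
(orthogonal decomposition along `range d⁰`, then along `zeroModes τ ⊆ ker d⁰`). -/
theorem exists_dZero_add_eq (τ : GaugeConfig d L G) (Ω : OneForm r d L) :
    ∃ η ∈ (zeroModes r τ)ᗮ, ∃ A ∈ slice r τ, dZero r τ η + A = Ω := by
  obtain ⟨y, hy, z, hz, hΩ⟩ :=
    Submodule.exists_add_mem_mem_orthogonal (K := LinearMap.range (dZero r τ)) Ω
  obtain ⟨η₀, rfl⟩ := LinearMap.mem_range.1 hy
  obtain ⟨ζ, hζ, η, hη, hη₀⟩ := Submodule.exists_add_mem_mem_orthogonal (K := zeroModes r τ) η₀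
  refine ⟨η, hη, z, hz, ?_⟩
  rw [hΩ, hη₀, map_add, dZero_eq_zero_of_mem_zeroModes r τ hζ, zero_add]

end L2

end SliceOpen

open SliceOpen in
/-- **The gauge-slice parametrisation covers a neighbourhood of `τ` (stub `stub_sliceOpen`).** For every `δ > 0` there
is an open `O ∋ τ` in `G^E` such that every `U ∈ O` is `gaugeExp η · cfg τ A` with `η ∈ (zeroModes τ)ᗮ`, `A ∈ slice τ`,
`‖η‖ < δ`, `‖A‖ < δ`. Inverse function theorem for the log-coordinates `Γ` of the parametrisation (strict derivative
`(η̇, Ȧ) ↦ d⁰η̇ + Ȧ`, onto), plus separation of points of `ρ(G)` near `1` by log-coordinates. -/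
theorem sliceOpen {G : Type} [Group G] [TopologicalSpace G] [CompactSpace G] (r : LatticeRep G) {d L : ℕ} [NeZero L]
    (τ : GaugeConfig d L G) (δ : ℝ) (hδ : 0 < δ) :
    ∃ O : Set (GaugeConfig d L G), IsOpen O ∧ τ ∈ O ∧ ∀ U ∈ O, ∃ (η : SiteFun r d L) (A : OneForm r d L),
      η ∈ (zeroModes r τ)ᗮ ∧ A ∈ slice r τ ∧ ‖η‖ < δ ∧ ‖A‖ < δ ∧ U = gaugeTransform (gaugeExp r η) (cfg r τ A) := by
  obtain ⟨Q, hQ⟩ := Summit.QuantumFields.YangMills.Theorems.FemtoCurvatureTwoPointC.SliceOpen.exists_leftInverse_lieIso r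
  obtain ⟨r₁, hr₁, hchart⟩ := Summit.QuantumFields.YangMills.Theorems.FemtoCurvatureTwoPointC.SliceOpen.exists_logChart_radius r Q hQ
  -- the parametrisation in matrices and its log-coordinates
  set Φ : ↥(zeroModes r τ)ᗮ × ↥(slice r τ) → Edge d L → Matrix (Fin r.N) (Fin r.N) ℂ := fun q e =>
    r.ρ (gaugeTransform (gaugeExp r (q.1 : SiteFun r d L)) (cfg r τ (q.2 : OneForm r d L)) e) * r.ρ (τ e)⁻¹ with hΦ
  set Γ : ↥(zeroModes r τ)ᗮ × ↥(slice r τ) → Edge d L → Fib r := fun q e => Q (localLog (Φ q e)) with hΓ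
  -- strict derivative of `Γ` at `0`, onto
  choose Γ' hΓ' hΓ'q using fun e => hasStrictFDerivAt_logParam r τ Q hQ e
  have hΓd : HasStrictFDerivAt Γ (ContinuousLinearMap.pi Γ') 0 := hasStrictFDerivAt_pi.2 hΓ'
  have hmap : map Γ (𝓝 0) = 𝓝 (Γ 0) := by
    refine hΓd.map_nhds_eq_of_surj (LinearMap.range_eq_top.2 fun Ω => ?_)
    obtain ⟨η, hη, A, hA, hΩ⟩ := exists_dZero_add_eq r τ (WithLp.toLp 2 Ω)
    refine ⟨(⟨η, hη⟩, ⟨A, hA⟩), funext fun e => ?_⟩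
    have h := congrArg (fun B : OneForm r d L => B e) hΩ
    simp only [PiLp.add_apply] at h
    simpa [hΓ'q] using h
  have hΦ0 : ∀ e, Φ 0 e = 1 := fun e => by
    simp only [hΦ, Prod.fst_zero, Prod.snd_zero, ZeroMemClass.coe_zero]
    exact rho_param_zero r τ e
  have hΓ0 : Γ 0 = 0 := funext fun e => by
    simp only [hΓ, hΦ0, localLog_one, map_zero, Pi.zero_apply]
  -- the good parameter set and its image, a neighbourhood of `0`
  set S : Set (↥(zeroModes r τ)ᗮ × ↥(slice r τ)) := Metric.ball 0 δ ∩ {q | ∀ e, ‖Φ q e - 1‖ < r₁} with hS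
  have hSn : S ∈ 𝓝 (0 : ↥(zeroModes r τ)ᗮ × ↥(slice r τ)) := by
    refine inter_mem (Metric.ball_mem_nhds _ hδ) (eventually_all.2 fun e => ?_)
    have hc : ContinuousAt (fun q : ↥(zeroModes r τ)ᗮ × ↥(slice r τ) => Φ q e) 0 := by
      simp only [hΦ]; exact (continuous_rhoParam r τ e).continuousAt
    have hb : Metric.ball (1 : Matrix (Fin r.N) (Fin r.N) ℂ) r₁ ∈ 𝓝 (Φ 0 e) := by
      rw [hΦ0]; exact Metric.ball_mem_nhds _ hr₁
    filter_upwards [hc.preimage_mem_nhds hb] with q hq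
    rwa [mem_preimage, Metric.mem_ball, dist_eq_norm] at hq
  have himg : Γ '' S ∈ 𝓝 (0 : Edge d L → Fib r) := by
    rw [← hΓ0, ← hmap]; exact image_mem_map hSn
  -- log-coordinates of a configuration near `τ`
  set Λ : GaugeConfig d L G → Edge d L → Fib r := fun U e => Q (localLog (r.ρ (U e) * r.ρ (τ e)⁻¹)) with hΛ
  have hcU : ∀ e, Continuous fun U : GaugeConfig d L G => r.ρ (U e) * r.ρ (τ e)⁻¹ := fun e =>
    (r.continuous.comp (continuous_apply e)).mul continuous_const
  have hΛc : ContinuousAt Λ τ := by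
    refine continuousAt_pi.2 fun e => ?_
    have h2 : ContinuousAt (localLog : Matrix (Fin r.N) (Fin r.N) ℂ → Matrix (Fin r.N) (Fin r.N) ℂ)
        (r.ρ (τ e) * r.ρ (τ e)⁻¹) := by
      rw [rho_mul_inv]; exact (contDiffAt_localLog (m := 0)).continuousAt
    exact Q.continuous.continuousAt.comp
      (ContinuousAt.comp (f := fun U : GaugeConfig d L G => r.ρ (U e) * r.ρ (τ e)⁻¹) (x := τ) h2
        (hcU e).continuousAt)
  have hΛτ : Λ τ = 0 := funext fun e => by
    simp only [hΛ, rho_mul_inv, localLog_one, map_zero, Pi.zero_apply]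
  have hO₀ : Λ ⁻¹' (Γ '' S) ∈ 𝓝 τ := hΛc.preimage_mem_nhds (by rwa [hΛτ])
  have hO₁ : {U : GaugeConfig d L G | ∀ e, ‖r.ρ (U e) * r.ρ (τ e)⁻¹ - 1‖ < r₁} ∈ 𝓝 τ := by
    refine eventually_all.2 fun e => ?_
    have hb : Metric.ball (1 : Matrix (Fin r.N) (Fin r.N) ℂ) r₁ ∈ 𝓝 (r.ρ (τ e) * r.ρ (τ e)⁻¹) := by
      rw [rho_mul_inv]; exact Metric.ball_mem_nhds _ hr₁
    filter_upwards [((hcU e).continuousAt (x := τ)).preimage_mem_nhds hb] with U hU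
    rwa [mem_preimage, Metric.mem_ball, dist_eq_norm] at hU
  refine ⟨interior (Λ ⁻¹' (Γ '' S) ∩ {U | ∀ e, ‖r.ρ (U e) * r.ρ (τ e)⁻¹ - 1‖ < r₁}), isOpen_interior,
    mem_interior_iff_mem_nhds.2 (inter_mem hO₀ hO₁), fun U hU => ?_⟩
  obtain ⟨⟨q, ⟨hqδ, hq₁⟩, hqU⟩, hU₁⟩ := interior_subset hU
  simp only [hΦ, mem_setOf_eq] at hq₁
  refine ⟨(q.1 : SiteFun r d L), (q.2 : OneForm r d L), q.1.2, q.2.2,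
    (norm_fst_le q).trans_lt (mem_ball_zero_iff.1 hqδ), (norm_snd_le q).trans_lt (mem_ball_zero_iff.1 hqδ), ?_⟩
  funext e
  -- both `U e · (τ e)⁻¹` and `(gaugeExp η · cfg τ A) e · (τ e)⁻¹` are chart points with the same log-coordinate
  obtain ⟨a₁, ha₁, hQa₁⟩ := hchart (gaugeTransform (gaugeExp r (q.1 : SiteFun r d L)) (cfg r τ (q.2 : OneForm r d L)) e *
    (τ e)⁻¹) (by rw [map_mul]; exact hq₁ e)
  obtain ⟨a₂, ha₂, hQa₂⟩ := hchart (U e * (τ e)⁻¹) (by rw [map_mul]; exact hU₁ e)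
  have hΓΛ : Γ q e = Λ U e := congrFun hqU e
  simp only [hΓ, hΦ, hΛ] at hΓΛ
  have ha : a₁ = a₂ := by
    rw [← hQa₁, ← hQa₂, map_mul, map_mul]
    exact hΓΛ
  have hg : U e * (τ e)⁻¹ =
      gaugeTransform (gaugeExp r (q.1 : SiteFun r d L)) (cfg r τ (q.2 : OneForm r d L)) e * (τ e)⁻¹ := by
    rw [← ha₂, ← ha₁, ha]
  exact mul_right_cancel hg

end Summit.QuantumFields.YangMills.Theorems.LocalInsertion.SublevelDoubling

end
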